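import Mathlib
import HarnessLib
import Literature.NumberTheory.Irrationality.Zudilin2014.SecondTaleComplex
import Summits.KontsevichZagierPeriods.Zeta5Search.TwoTaleSechMoments

/-!
# Second tale: the line representation `q̂ζ(2) − p̂ = ± (4π)⁻¹ ∫ sech1(y) R̂((½ + iy − â₀*)/2) dy`

HONEST FRAMING: systematic search; no irrationality claim unless certified.  Cell pub-zeta5, class `measure`
(fam-measure g5, file U2-3 of the tale-2 decay chain for `Denom.TwoTaleP15Coincidence.DecayT`; design value,
formalisation pending).  Pure analysis + algebra: the only zeta value is the DEFINED constant `zetaValue 2`.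

For a general admissible second-tale datum `(â, b̂)` ([Zudilin2014ZetaTwo, Section 6]) we prove the analytic half of
[Zudilin2014ZetaTwo, Prop. 3] in the doubled variable `u = 2t + â₀*`:

* starting from the tree's `RCT a b s = numT(s)/denT(s)` over `ℂ` and its partial fractions `RCT_eq_polar`
  (`Literature…Zudilin2014.SecondTaleComplex`, [Zudilin2014ZetaTwo, display before eq. (T2)]):
  in the variable `u`, `t + k = (u + K_k)/2` with `K_k = 2k − â₀* ∈ ℕ`, so `R̂ = Σ 4A_k/(u+K_k)² + Σ 2B_k/(u+K_k)`
  (`RCT_u_expand`);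
* `lineT a b x := ∫ sech1(y) · RCT((x + iy − â₀*)/2) dy`; on the line `x = ½` the polar moments of U2-2 give
  **`lineT(½) = (−1)^{K} · 4π · (ζ(2) Σ_k A_k − (Σ_k 2A_k harmAlt2 K_k + Σ_k B_k harmAlt1 K_k))`** (`lineT_half_closed`;
  the unevaluated `P¹_0(½)` drops out by `Σ_k B_k = 0`, the tree's `sum_coefBT_eq_zero` = eq. (T4)), whence
  **`q̂·ζ(2) − p̂ = signT · (−1)^{K} /(4π) · lineT(½)`** (`lineRepT`) and `|q̂ ζ(2) − p̂| = ‖lineT(½)‖/(4π)`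
  (`abs_formT_eq`), for the forms `formQT`, `formPT` of `Zudilin2014.SecondTale`.
-/

noncomputable section

open Complex MeasureTheory Finset Polynomial
open Literature.NumberTheory.Transcendental
open Literature.NumberTheory.Irrationality.Zudilin2014
open Summit.KontsevichZagierPeriods.Zeta5Search.Denom.KernelStripStep
open Summit.KontsevichZagierPeriods.Zeta5Search.Denom.KernelPolarMoment (norm_inv_add_natCast_le
  differentiableOn_inv_add_natCast)
open Summit.KontsevichZagierPeriods.Zeta5Search.TwoTaleSechKernel
open Summit.KontsevichZagierPeriods.Zeta5Search.TwoTaleSechMoments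

namespace Summit.KontsevichZagierPeriods.Zeta5Search.TwoTaleSecondTaleLineRep

variable {a b : Fin 4 → ℤ}

/-! ### `R̂` over `ℂ`: the tree's `RCT a b s = numT(s)/denT(s)` and its partial fractions `RCT_eq_polar`
(`Literature…Zudilin2014.SecondTaleComplex`) are used by name. -/

/-! ### The doubled variable `u = 2t + â₀*`: `t + k = (u + K_k)/2`, `K_k = 2k − â₀* ∈ ℕ` -/

/-- `K_k = 2k − â₀* ≥ 0` for `k ≥ â₂*` (as `â₀* ≤ 2â₂*`). -/
theorem momentIdx_cast {k : ℤ} (hk : aMid a ≤ k) : (((2 * k - a0star a).toNat : ℕ) : ℤ) = 2 * k - a0star a := by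
  have : a0star a ≤ 2 * aMid a := min_le_right _ _
  exact Int.toNat_of_nonneg (by omega)

/-- `K_k` over `ℂ`. -/
theorem momentIdx_castC {k : ℤ} (hk : aMid a ≤ k) :
    (((2 * k - a0star a).toNat : ℕ) : ℂ) = 2 * (k : ℂ) - (a0star a : ℂ) := by
  have h := congrArg (Int.cast : ℤ → ℂ) (momentIdx_cast hk)
  push_cast at h
  exact h

/-- All `K_k`, `k ≥ â₂*`, have the parity of `K_{â₂*}`: `(−1)^{K_k} = (−1)^{K_{â₂*}}`. -/
theorem neg_one_pow_momentIdx {k : ℤ} (hk : aMid a ≤ k) :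
    (-1 : ℂ) ^ (2 * k - a0star a).toNat = (-1) ^ (2 * aMid a - a0star a).toNat := by
  have h0 : a0star a ≤ 2 * aMid a := min_le_right _ _
  have h : (2 * k - a0star a).toNat = (2 * aMid a - a0star a).toNat + 2 * (k - aMid a).toNat := by omega
  rw [h, pow_add, pow_mul, neg_one_sq, one_pow, mul_one]

/-- `â₂* ≤ â₃*`. -/
private theorem aMid_le_aMax3 (a : Fin 4 → ℤ) : aMid a ≤ aMax3 a := by
  unfold aMid aMax3; omega

/-- The shift: `(u − â₀*)/2 + k = (u + K_k)/2`. -/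
theorem shift_eq {k : ℤ} (hk : aMid a ≤ k) (u : ℂ) :
    (u - a0star a) / 2 + k = (u + ((2 * k - a0star a).toNat : ℕ)) / 2 := by
  rw [momentIdx_castC hk]; ring

/-- **`R̂` in the doubled variable**: `R̂((u−â₀*)/2) = Σ 4A_k/(u+K_k)² + Σ 2B_k/(u+K_k)`. -/
theorem RCT_u_expand (hab : AdmissibleT a b) (u : ℂ) (hu : ∀ k ∈ poleSet a b, (u - a0star a) / 2 + k ≠ 0) :
    RCT a b ((u - a0star a) / 2) =
      ∑ k ∈ Ico (aMax3 a) (bMin b), 4 * (coefAT a b k : ℂ) / (u + ((2 * k - a0star a).toNat : ℕ)) ^ 2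
        + ∑ k ∈ Ico (aMid a) (bMax b), 2 * (coefBT a b k : ℂ) / (u + ((2 * k - a0star a).toNat : ℕ)) := by
  rw [RCT_eq_polar hab hu]
  have hm := aMid_le_aMax3 a
  congr 1
  · refine sum_congr rfl fun k hk => ?_
    rw [shift_eq (hm.trans (mem_Ico.1 hk).1), div_pow, div_div_eq_mul_div]; ring
  · refine sum_congr rfl fun k hk => ?_
    rw [shift_eq (mem_Ico.1 hk).1, div_div_eq_mul_div]; ring

/-! ### The line integral -/

/-- **The line integral** `lineT(x) = ∫ sech1(y) · R̂((x + iy − â₀*)/2) dy` (the representation uses `x = ½`). -/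
def lineT (a b : Fin 4 → ℤ) (x : ℝ) : ℂ :=
  ∫ y : ℝ, ((sech1 y : ℝ) : ℂ) * RCT a b ((((x : ℂ) + (y : ℂ) * I) - a0star a) / 2)

/-- On the line `x = ½` no shifted point `(u − â₀*)/2 + k` vanishes (its real part is `k + ¼ − â₀*/2 ∉ ℤ/2`). -/
theorem half_line_ne_zero (a : Fin 4 → ℤ) (y : ℝ) (k : ℤ) :
    ((((1 / 2 : ℝ) : ℂ) + (y : ℂ) * I) - a0star a) / 2 + k ≠ 0 := by
  intro h
  have h2 : (((1 / 2 : ℝ) : ℂ) + (y : ℂ) * I) - a0star a + 2 * k = 0 := by linear_combination 2 * h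
  have hre := congrArg Complex.re h2
  simp only [add_re, sub_re, mul_re, ofReal_re, ofReal_im, I_re, I_im, intCast_re, intCast_im, re_ofNat,
    im_ofNat, zero_re, mul_zero, mul_one, sub_zero] at hre
  have hz : ((1 - 2 * a0star a + 4 * k : ℤ) : ℝ) = 0 := by push_cast; linarith
  have := (Int.cast_eq_zero).1 hz
  omega

/-- Integrability of the polar pieces on the line `x = ½` (first order). -/
private theorem integrable_polar1_half (K : ℕ) :
    Integrable fun y : ℝ => ((sech1 y : ℝ) : ℂ) * (1 / (((1 / 2 : ℝ) : ℂ) + (y : ℂ) * I + K)) := by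
  have hx : (1 / 2 : ℝ) ∈ Set.Icc ((((1 : ℕ) : ℤ) : ℝ) - 1 / 2) ((((1 : ℕ) : ℤ) : ℝ) + 1 / 2) := by
    constructor <;> push_cast <;> norm_num
  exact integrable_sech1_line (differentiableOn_inv_add_natCast le_rfl K) (norm_inv_add_natCast_le (k := K) le_rfl) hx

/-- Integrability of the polar pieces on the line `x = ½` (second order). -/
private theorem integrable_polar2_half (K : ℕ) :
    Integrable fun y : ℝ => ((sech1 y : ℝ) : ℂ) * (1 / (((1 / 2 : ℝ) : ℂ) + (y : ℂ) * I + K) ^ 2) := by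
  have hx : (1 / 2 : ℝ) ∈ Set.Icc ((((1 : ℕ) : ℤ) : ℝ) - 1 / 2) ((((1 : ℕ) : ℤ) : ℝ) + 1 / 2) := by
    constructor <;> push_cast <;> norm_num
  exact integrable_sech1_line (differentiableOn_inv_add_natCast_sq le_rfl K)
    (norm_inv_add_natCast_sq_le (K := K) le_rfl) hx

/-- **Expansion of `lineT(½)` in polar moments**:
`lineT(½) = Σ 4A_k P²_{K_k}(½) + Σ 2B_k P¹_{K_k}(½)`. -/
theorem lineT_half_eq (hab : AdmissibleT a b) :
    lineT a b (1 / 2) =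
      ∑ k ∈ Ico (aMax3 a) (bMin b), 4 * (coefAT a b k : ℂ) * polarLine2 (2 * k - a0star a).toNat (1 / 2)
        + ∑ k ∈ Ico (aMid a) (bMax b), 2 * (coefBT a b k : ℂ) * polarLine1 (2 * k - a0star a).toNat (1 / 2) := by
  have hfun : (fun y : ℝ => ((sech1 y : ℝ) : ℂ) * RCT a b (((((1 / 2 : ℝ) : ℂ) + (y : ℂ) * I) - a0star a) / 2)) =
      fun y : ℝ => ∑ k ∈ Ico (aMax3 a) (bMin b), 4 * (coefAT a b k : ℂ) *
          (((sech1 y : ℝ) : ℂ) * (1 / (((1 / 2 : ℝ) : ℂ) + (y : ℂ) * I + ((2 * k - a0star a).toNat : ℕ)) ^ 2))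
        + ∑ k ∈ Ico (aMid a) (bMax b), 2 * (coefBT a b k : ℂ) *
          (((sech1 y : ℝ) : ℂ) * (1 / (((1 / 2 : ℝ) : ℂ) + (y : ℂ) * I + ((2 * k - a0star a).toNat : ℕ)))) := by
    funext y
    rw [RCT_u_expand hab _ fun k _ => half_line_ne_zero a y k, mul_add, mul_sum, mul_sum]
    congr 1 <;> refine sum_congr rfl fun _ _ => ?_ <;> ring
  have hI2 : ∀ k ∈ Ico (aMax3 a) (bMin b), Integrable fun y : ℝ => 4 * (coefAT a b k : ℂ) *
      (((sech1 y : ℝ) : ℂ) * (1 / (((1 / 2 : ℝ) : ℂ) + (y : ℂ) * I + ((2 * k - a0star a).toNat : ℕ)) ^ 2)) :=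
    fun k _ => (integrable_polar2_half _).const_mul _
  have hI1 : ∀ k ∈ Ico (aMid a) (bMax b), Integrable fun y : ℝ => 2 * (coefBT a b k : ℂ) *
      (((sech1 y : ℝ) : ℂ) * (1 / (((1 / 2 : ℝ) : ℂ) + (y : ℂ) * I + ((2 * k - a0star a).toNat : ℕ)))) :=
    fun k _ => (integrable_polar1_half _).const_mul _
  unfold lineT
  rw [hfun, integral_add (integrable_finsetSum _ hI2) (integrable_finsetSum _ hI1), integral_finsetSum _ hI2,
    integral_finsetSum _ hI1]
  simp only [integral_const_mul]
  rfl

/-- `Σ_{k=â₂*}^{b̂₃*−1} B_k = 0` over `ℂ` ([Zudilin2014ZetaTwo, eq. (T4)], the tree's `sum_coefBT_eq_zero`). -/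
theorem sum_coefBT_castC (hab : AdmissibleT a b) : ∑ k ∈ Ico (aMid a) (bMax b), (coefBT a b k : ℂ) = 0 := by
  have h := congrArg (Rat.cast : ℚ → ℂ) (sum_coefBT_eq_zero hab)
  push_cast at h
  exact h

/-- **`lineT(½)` in closed form**: with `ε = (−1)^{K_{â₂*}}`,
`lineT(½) = ε · 4π · (ζ(2) Σ A_k − (Σ 2A_k·harmAlt2 K_k + Σ B_k·harmAlt1 K_k))`. -/
theorem lineT_half_closed (hab : AdmissibleT a b) :
    lineT a b (1 / 2) = (-1 : ℂ) ^ (2 * aMid a - a0star a).toNat * (4 * Real.pi) *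
      (zetaValue 2 * ∑ k ∈ Ico (aMax3 a) (bMin b), (coefAT a b k : ℂ)
        - (∑ k ∈ Ico (aMax3 a) (bMin b), 2 * (coefAT a b k : ℂ) * (harmAlt2 (2 * k - a0star a).toNat : ℂ)
          + ∑ k ∈ Ico (aMid a) (bMax b), (coefBT a b k : ℂ) * (harmAlt1 (2 * k - a0star a).toNat : ℂ))) := by
  set ε : ℂ := (-1 : ℂ) ^ (2 * aMid a - a0star a).toNat with hε
  have hm := aMid_le_aMax3 a
  have hsq : ∀ K : ℕ, ((-1 : ℂ) ^ K) * (-1 : ℂ) ^ K = 1 := fun K => by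
    rw [← pow_add, ← two_mul, pow_mul, neg_one_sq, one_pow]
  have hP2 : ∀ k ∈ Ico (aMax3 a) (bMin b), polarLine2 (2 * k - a0star a).toNat (1 / 2) =
      ε * (Real.pi * zetaValue 2 - 2 * Real.pi * (harmAlt2 (2 * k - a0star a).toNat : ℂ)) := by
    intro k hk
    rw [← polarLine2_half_closed, ← mul_assoc, hε, ← neg_one_pow_momentIdx (hm.trans (mem_Ico.1 hk).1), hsq,
      one_mul]
  have hP1 : ∀ k ∈ Ico (aMid a) (bMax b), polarLine1 (2 * k - a0star a).toNat (1 / 2) =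
      ε * (polarLine1 0 (1 / 2) - 2 * Real.pi * (harmAlt1 (2 * k - a0star a).toNat : ℂ)) := by
    intro k hk
    rw [← polarLine1_half_closed, ← mul_assoc, hε, ← neg_one_pow_momentIdx (mem_Ico.1 hk).1, hsq, one_mul]
  have hB := sum_coefBT_castC hab
  have e1 : ∑ k ∈ Ico (aMax3 a) (bMin b), 4 * (coefAT a b k : ℂ) * polarLine2 (2 * k - a0star a).toNat (1 / 2) =
      ε * (4 * Real.pi) * (zetaValue 2 * ∑ k ∈ Ico (aMax3 a) (bMin b), (coefAT a b k : ℂ)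
        - ∑ k ∈ Ico (aMax3 a) (bMin b), 2 * (coefAT a b k : ℂ) * (harmAlt2 (2 * k - a0star a).toNat : ℂ)) := by
    rw [mul_sub, mul_sum, mul_sum, mul_sum, ← sum_sub_distrib]
    exact sum_congr rfl fun k hk => by rw [hP2 k hk]; ring
  have e2 : ∑ k ∈ Ico (aMid a) (bMax b), 2 * (coefBT a b k : ℂ) * polarLine1 (2 * k - a0star a).toNat (1 / 2) =
      2 * ε * polarLine1 0 (1 / 2) * ∑ k ∈ Ico (aMid a) (bMax b), (coefBT a b k : ℂ)
        - ε * (4 * Real.pi) * ∑ k ∈ Ico (aMid a) (bMax b),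
          (coefBT a b k : ℂ) * (harmAlt1 (2 * k - a0star a).toNat : ℂ) := by
    rw [mul_sum, mul_sum, ← sum_sub_distrib]
    exact sum_congr rfl fun k hk => by rw [hP1 k hk]; ring
  rw [lineT_half_eq hab, e1, e2, hB, mul_zero, zero_sub]
  ring

/-- `signT² = 1` over `ℂ`. -/
theorem signT_sq (b : Fin 4 → ℤ) : (signT b : ℂ) * (signT b : ℂ) = 1 := by
  unfold signT; push_cast
  rw [← pow_add, ← two_mul, pow_mul, neg_one_sq, one_pow]

/-- **The line representation of the second-tale forms** ([Zudilin2014ZetaTwo, Prop. 3], analytic half):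
`q̂·ζ(2) − p̂ = signT · (−1)^{K_{â₂*}} /(4π) · ∫ sech1(y) R̂((½ + iy − â₀*)/2) dy`. -/
theorem lineRepT (hab : AdmissibleT a b) :
    (((formQT a b : ℝ) * zetaValue 2 - (formPT a b : ℝ) : ℝ) : ℂ) =
      (signT b : ℂ) * (-1 : ℂ) ^ (2 * aMid a - a0star a).toNat / (4 * Real.pi) * lineT a b (1 / 2) := by
  have hπ : (4 * Real.pi : ℂ) ≠ 0 := mul_ne_zero (by norm_num) (by exact_mod_cast Real.pi_ne_zero)
  have hsq : ((-1 : ℂ) ^ (2 * aMid a - a0star a).toNat) * (-1 : ℂ) ^ (2 * aMid a - a0star a).toNat = 1 := by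
    rw [← pow_add, ← two_mul, pow_mul, neg_one_sq, one_pow]
  set X : ℂ := zetaValue 2 * ∑ k ∈ Ico (aMax3 a) (bMin b), (coefAT a b k : ℂ)
    - (∑ k ∈ Ico (aMax3 a) (bMin b), 2 * (coefAT a b k : ℂ) * (harmAlt2 (2 * k - a0star a).toNat : ℂ)
      + ∑ k ∈ Ico (aMid a) (bMax b), (coefBT a b k : ℂ) * (harmAlt1 (2 * k - a0star a).toNat : ℂ)) with hX
  rw [lineT_half_closed hab, ← hX]
  have hR : (signT b : ℂ) * (-1 : ℂ) ^ (2 * aMid a - a0star a).toNat / (4 * Real.pi) *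
      ((-1 : ℂ) ^ (2 * aMid a - a0star a).toNat * (4 * Real.pi) * X) =
      (signT b : ℂ) * (((-1 : ℂ) ^ (2 * aMid a - a0star a).toNat) * (-1 : ℂ) ^ (2 * aMid a - a0star a).toNat) *
        ((4 * Real.pi) / (4 * Real.pi)) * X := by
    ring
  rw [hR, hsq, div_self hπ, mul_one, mul_one, hX]
  unfold formQT formPT
  push_cast
  ring

/-- **Corollary**: `|q̂·ζ(2) − p̂| = ‖lineT(½)‖ / (4π)`. -/
theorem abs_formT_eq (hab : AdmissibleT a b) :
    |(formQT a b : ℝ) * zetaValue 2 - (formPT a b : ℝ)| = ‖lineT a b (1 / 2)‖ / (4 * Real.pi) := by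
  have h := congrArg (fun z : ℂ => ‖z‖) (lineRepT hab)
  simp only [Complex.norm_real, Real.norm_eq_abs] at h
  have hS : ‖(signT b : ℂ)‖ = 1 := by
    unfold signT; push_cast; rw [norm_pow, norm_neg, norm_one, one_pow]
  have hε : ‖(-1 : ℂ) ^ (2 * aMid a - a0star a).toNat‖ = 1 := by rw [norm_pow, norm_neg, norm_one, one_pow]
  have h4 : ‖(4 * Real.pi : ℂ)‖ = 4 * Real.pi := by
    rw [show (4 * (Real.pi : ℂ)) = ((4 * Real.pi : ℝ) : ℂ) by push_cast; ring, Complex.norm_real,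
      Real.norm_eq_abs, abs_of_pos (by positivity)]
  rw [h, norm_mul, norm_div, norm_mul, hS, hε, h4]
  ring

end Summit.KontsevichZagierPeriods.Zeta5Search.TwoTaleSecondTaleLineRep

end
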